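import Summits.PneNP.PneNP.Theorems.ConvexRankGatesLinAlgGateBlindLogWidthPerm
import Summits.PneNP.PneNP.Theorems.ConvexRankGatesLinAlgGateBlindSpanChainCover
import Summits.PneNP.PneNP.Theorems.ConvexRankGatesLinAlgGateBlindCommPermSmallDim
import Summits.PneNP.PneNP.Theorems.ConvexRankGatesLinAlgGateBlindSpanProgramSmallDim

/-!
# Route ConvexRankGates, crux `LinAlgGateBlind` (stmt-PneNP-10681): the span-program and commutative-PERM doors at logarithmic atom width

Support theorems for the crux (vocabulary of `Theorems/ConvexRankGatesLinAlgGateBlindDefs.lean`). The tree's single-gate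
statements for span programs over a division ring (`sgAt_spanGateOver_of_dim_le_rpow`, `D ≤ m^{11/16}/(8 log₂ m)`), for
commutative `PERM_d` gates (`sgAt_commPerm_of_fewPoints`, `log₂ d! ≤ m^{3/4}/2`) and for `𝔽_p`-span programs
(`sgAt_spanGate_of_dim_le`, `D log₂ p ≤ m^{3/4}/2`) are all instances of parametric cover-budget theorems
(`sg_spanProgram_of_chain_budget`, `sgAt_commPerm_of_cover_budget`, `sg_spanProgram_of_cover_budget`) at the line's atom
width `lOf m ≈ m^{1/16}`. At the LOGARITHMIC width `L(c,m) = (2c+8)(⌊log₂ m⌋+1)` of `…LogWidthPerm` (planting depth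
`t = (c+4)(⌊log₂ m⌋+1)`, fragility `ν = ⌊m/(2 k C(L,2))⌋ ≈ m^{7/8}/polylog m`) the same theorems give the ranges

* `sgAt_spanGateOver_logWidth` — span programs over ANY division ring, `D ≤ m^{7/8}/(log₂ m)^5`;
* `sgAt_commPerm_logWidth` — commutative `PERM_d`, `log₂ d! ≤ m^{7/8}/(log₂ m)^5`;
* `sgAt_spanGate_zmod_logWidth` — `𝔽_p`-span programs, `D log₂ p ≤ m^{7/8}/(log₂ m)^5`,

all at every level `c`, eventually in `m`, from ONE bookkeeping lemma `logWidth_common` (the dense-regime facts, the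
positive budget `pos_budget_of_base`, and the bit budget `T + Λ(c+1) + 2 ≤ ν` for any bit count
`T ≤ 16 (c+4) log₂² m · m^{7/8}/(log₂ m)^5`, via `logWidth_budget_algebra_T`) and the two-factor cover budget
`cover_budget_two_pow`. The circuit lower bounds follow by the level-`l` door theorem (file `…LogWidthDoorsCircuit`).
Sources: Razborov 1985, Alon–Boppana 1987 §3; planting theorem, chain/character/functional covers are the tree's.
No new definitions. [folklore]
-/

-- `Summit.PneNP.PneNP.…` duplicates `PneNP` BY DESIGN (single-problem summit).
set_option linter.dupNamespace false

noncomputable section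

namespace Summit.PneNP.PneNP.Theorems

open Finset Filter Literature.Computability.Complexity Razborov
open Summit.PneNP.PneNP.Cruxes.LinAlgGateBlind.DnfInvariantWideGatesSeeSmallCliques
open Summit.PneNP.PneNP.Cruxes.LinAlgGateBlind.DnfInvariantWideGatesSeeSmallCliques.DenseRegime

/-! ### Generic budgets at logarithmic width -/

/-- **Two-factor cover budget from a bit count.** If `0 ≤ X ≤ 2^a`, `V ≤ 2^b`, `a + b + Λ(c+1) + 3 ≤ ν + 1` and
`m ≤ 2^Λ` (`m ≥ 1`), then `X (1/2)^{ν+1} V ≤ 2^{-Λ(c+1)-3} < ε = 1/(4 m^{c+1})`. [folklore] -/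
theorem cover_budget_two_pow {c m a b Λ ν : ℕ} {X V : ℝ} (hm : 1 ≤ m) (hX0 : 0 ≤ X) (hX : X ≤ (2 : ℝ) ^ a)
    (hV : V ≤ (2 : ℝ) ^ b) (hB : a + b + (Λ * (c + 1) + 3) ≤ ν + 1) (hmΛ : m ≤ 2 ^ Λ) :
    X * (1 / 2) ^ (ν + 1) * V < epsOf c m := by
  have hmpos : (0 : ℝ) < m := by exact_mod_cast hm
  rcases lt_or_ge V 0 with hVneg | hV0
  · have hε : 0 < epsOf c m := by rw [epsOf_eq]; positivity
    have : X * (1 / 2) ^ (ν + 1) * V ≤ 0 :=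
      mul_nonpos_of_nonneg_of_nonpos (mul_nonneg hX0 (by positivity)) hVneg.le
    linarith
  have hA : X * V ≤ (2 : ℝ) ^ (a + b) := by rw [pow_add]; exact mul_le_mul hX hV hV0 (by positivity)
  have hhalfpow : (1 / 2 : ℝ) ^ (ν + 1) ≤ (1 / 2) ^ (a + b + (Λ * (c + 1) + 3)) :=
    pow_le_pow_of_le_one (by norm_num) (by norm_num) hB
  have hm2 : (m : ℝ) ^ (c + 1) ≤ (2 : ℝ) ^ (Λ * (c + 1)) := by
    calc (m : ℝ) ^ (c + 1) ≤ ((2 ^ Λ : ℕ) : ℝ) ^ (c + 1) :=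
          pow_le_pow_left₀ (Nat.cast_nonneg _) (by exact_mod_cast hmΛ) _
      _ = (2 : ℝ) ^ (Λ * (c + 1)) := by push_cast; rw [← pow_mul]
  have hpow2 : (0 : ℝ) < (2 : ℝ) ^ (Λ * (c + 1)) := by positivity
  calc X * (1 / 2) ^ (ν + 1) * V = X * V * (1 / 2) ^ (ν + 1) := by ring
    _ ≤ (2 : ℝ) ^ (a + b) * (1 / 2) ^ (a + b + (Λ * (c + 1) + 3)) :=
        mul_le_mul hA hhalfpow (by positivity) (by positivity)
    _ = ((2 : ℝ) * (1 / 2)) ^ (a + b) * (1 / 2) ^ (Λ * (c + 1) + 3) := by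
        rw [pow_add (1 / 2 : ℝ) (a + b), ← mul_assoc, ← mul_pow]
    _ = (1 / 2) ^ (Λ * (c + 1)) * (1 / 2) ^ 3 := by rw [pow_add (1 / 2 : ℝ) (Λ * (c + 1)) 3]; norm_num
    _ = 1 / (8 * (2 : ℝ) ^ (Λ * (c + 1))) := by rw [one_div_pow, one_div_pow]; ring
    _ < 1 / (4 * (2 : ℝ) ^ (Λ * (c + 1))) := by
        apply one_div_lt_one_div_of_lt (by positivity)
        linarith
    _ ≤ 1 / (4 * (m : ℝ) ^ (c + 1)) := by
        apply one_div_le_one_div_of_le (by positivity)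
        linarith
    _ = epsOf c m := (epsOf_eq c m).symm

/-- **The budget algebra with a bit count `T` (abstract reals).** If `ℓ ≥ 576 (c+4)³`, `ℓ⁵ ≤ y`, `Λ ≤ 2ℓ`,
`C ≤ 8(c+4)²ℓ²`, `k ≤ 2s` and `T ≤ 16 (c+4) ℓ² · (y/ℓ⁵)`, then `(T + Λ(c+1) + 2)(2kC) ≤ 576 (c+4)³ s y/ℓ ≤ s y`. [folklore] -/
theorem logWidth_budget_algebra_T {c ℓ s y Λ C k T : ℝ} (hc0 : 0 ≤ c) (hℓ : 576 * (c + 4) ^ 3 ≤ ℓ)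
    (hs0 : 0 ≤ s) (hy5 : ℓ ^ 5 ≤ y) (hΛ : Λ ≤ 2 * ℓ) (hΛ0 : 0 ≤ Λ) (hC : C ≤ 8 * (c + 4) ^ 2 * ℓ ^ 2) (hC0 : 0 ≤ C)
    (hk : k ≤ 2 * s) (hk0 : 0 ≤ k) (hT : T ≤ 16 * (c + 4) * ℓ ^ 2 * (y / ℓ ^ 5)) :
    (T + Λ * (c + 1) + 2) * (2 * k * C) ≤ s * y := by
  have hc4 : (64 : ℝ) ≤ (c + 4) ^ 3 := by
    have h := pow_le_pow_left₀ (by norm_num : (0 : ℝ) ≤ 4) (by linarith : (4 : ℝ) ≤ c + 4) 3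
    linarith [show ((4 : ℝ)) ^ 3 = 64 by norm_num]
  have hℓ1 : (1 : ℝ) ≤ ℓ := by nlinarith
  have hℓ0 : (0 : ℝ) < ℓ := by linarith
  have hℓ5 : (0 : ℝ) < ℓ ^ 5 := pow_pos hℓ0 5
  have hy0 : 0 < y := lt_of_lt_of_le hℓ5 hy5
  set β := y / ℓ ^ 5 with hβ
  have hβ1 : 1 ≤ β := by rwa [hβ, le_div_iff₀ hℓ5, one_mul]
  have hβ0 : 0 ≤ β := by linarith
  have hX : T + Λ * (c + 1) + 2 ≤ 18 * (c + 4) * ℓ ^ 2 * β := by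
    have h2 : Λ * (c + 1) + 2 ≤ 2 * (c + 4) * ℓ ^ 2 * β := by
      have h21 : Λ * (c + 1) + 2 ≤ 2 * ℓ * (c + 1) + 2 * ℓ := by nlinarith
      have h23 : ℓ ≤ ℓ ^ 2 * β := by nlinarith
      nlinarith
    linarith
  have hN : 2 * k * C ≤ 32 * (c + 4) ^ 2 * s * ℓ ^ 2 := by
    calc 2 * k * C ≤ 2 * (2 * s) * (8 * (c + 4) ^ 2 * ℓ ^ 2) :=
          mul_le_mul (mul_le_mul_of_nonneg_left hk (by norm_num)) hC hC0 (by positivity)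
      _ = 32 * (c + 4) ^ 2 * s * ℓ ^ 2 := by ring
  have h18 : (0 : ℝ) ≤ 18 * (c + 4) * ℓ ^ 2 * β := by positivity
  calc (T + Λ * (c + 1) + 2) * (2 * k * C)
      ≤ (18 * (c + 4) * ℓ ^ 2 * β) * (32 * (c + 4) ^ 2 * s * ℓ ^ 2) := mul_le_mul hX hN (by positivity) h18
    _ = 576 * (c + 4) ^ 3 * (s * y) / ℓ := by
        rw [hβ]
        field_simp
        ring
    _ ≤ ℓ * (s * y) / ℓ := by
        apply div_le_div_of_nonneg_right _ hℓ0.le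
        exact mul_le_mul_of_nonneg_right hℓ (mul_nonneg hs0 hy0.le)
    _ = s * y := by field_simp

/-- **The real facts of the logarithmic width (small context).** For `m ≥ 4` with `log₂ m ≥ 576 (c+4)³`:
`1 ≤ log₂ m`, `Λ ≤ 2 log₂ m`, `L ≤ 4(c+4) log₂ m`, `C(L,2) ≤ 8(c+4)² log₂² m`, `k ≤ 2 m^{1/8}`, `Λ·L ≤ 8(c+4) log₂² m`
(`Λ = ⌊log₂ m⌋ + 1`, `L = (2c+8)Λ`, `k = kOf m`; all in `push_cast` normal form). [folklore] -/
theorem logWidth_real_facts {c m : ℕ} (hm4 : 4 ≤ m) (hbig : 576 * ((c : ℝ) + 4) ^ 3 ≤ Real.logb 2 m) :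
    1 ≤ Real.logb 2 m ∧ (Nat.log 2 m : ℝ) + 1 ≤ 2 * Real.logb 2 m ∧ (0 : ℝ) ≤ (Nat.log 2 m : ℝ) + 1 ∧
    (2 * (c : ℝ) + 8) * ((Nat.log 2 m : ℝ) + 1) ≤ 4 * ((c : ℝ) + 4) * Real.logb 2 m ∧
    (0 : ℝ) ≤ (2 * (c : ℝ) + 8) * ((Nat.log 2 m : ℝ) + 1) ∧
    (((((2 * c + 8) * (Nat.log 2 m + 1)).choose 2 : ℕ) : ℝ)) ≤ 8 * ((c : ℝ) + 4) ^ 2 * Real.logb 2 m ^ 2 ∧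
    (kOf m : ℝ) ≤ 2 * (m : ℝ) ^ (1 / 8 : ℝ) ∧
    ((Nat.log 2 m : ℝ) + 1) * ((2 * (c : ℝ) + 8) * ((Nat.log 2 m : ℝ) + 1)) ≤ 8 * ((c : ℝ) + 4) * Real.logb 2 m ^ 2 := by
  have hm1 : 1 ≤ m := by omega
  have hc0 : (0 : ℝ) ≤ c := Nat.cast_nonneg c
  have hc4 : (64 : ℝ) ≤ ((c : ℝ) + 4) ^ 3 := by
    have h := pow_le_pow_left₀ (by norm_num : (0 : ℝ) ≤ 4) (by linarith : (4 : ℝ) ≤ (c : ℝ) + 4) 3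
    linarith [show ((4 : ℝ)) ^ 3 = 64 by norm_num]
  have hℓ1 : (1 : ℝ) ≤ Real.logb 2 m := by nlinarith
  have hΛ : (Nat.log 2 m : ℝ) + 1 ≤ 2 * Real.logb 2 m := by
    have h := Real.natLog_le_logb m 2
    push_cast at h; linarith
  have hΛ0 : (0 : ℝ) ≤ (Nat.log 2 m : ℝ) + 1 := by linarith [(Nat.cast_nonneg _ : (0 : ℝ) ≤ (Nat.log 2 m : ℝ))]
  have hL : (2 * (c : ℝ) + 8) * ((Nat.log 2 m : ℝ) + 1) ≤ 4 * ((c : ℝ) + 4) * Real.logb 2 m := by nlinarith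
  have hL0 : (0 : ℝ) ≤ (2 * (c : ℝ) + 8) * ((Nat.log 2 m : ℝ) + 1) := mul_nonneg (by linarith) hΛ0
  have hsq : ((2 * (c : ℝ) + 8) * ((Nat.log 2 m : ℝ) + 1)) ^ 2 ≤ (4 * ((c : ℝ) + 4) * Real.logb 2 m) ^ 2 :=
    pow_le_pow_left₀ hL0 hL 2
  have hC : (((((2 * c + 8) * (Nat.log 2 m + 1)).choose 2 : ℕ) : ℝ)) ≤ 8 * ((c : ℝ) + 4) ^ 2 * Real.logb 2 m ^ 2 := by
    rw [Nat.cast_choose_two]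
    have hcast : ((((2 * c + 8) * (Nat.log 2 m + 1) : ℕ) : ℝ)) = (2 * (c : ℝ) + 8) * ((Nat.log 2 m : ℝ) + 1) := by
      push_cast; ring
    rw [hcast]
    nlinarith
  have hk : (kOf m : ℝ) ≤ 2 * (m : ℝ) ^ (1 / 8 : ℝ) := by
    have := kOf_le_two_mul_sq hm1
    rwa [rpow_sixteenth_sq] at this
  exact ⟨hℓ1, hΛ, hΛ0, hL, hL0, hC, hk, by nlinarith⟩

/-- **The bit budget at logarithmic width (small context).** For `m ≥ 4` with `log₂ m ≥ 576 (c+4)³`, `log₂⁵ m ≤ m^{7/8}` and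
`T ≤ 16 (c+4) log₂² m · m^{7/8}/(log₂ m)^5`: `(T + Λ(c+1) + 2) · (2 k C(L,2)) ≤ m` (`logWidth_budget_algebra_T`). [folklore] -/
theorem logWidth_bits_of_T {c m T : ℕ} (hm4 : 4 ≤ m) (hbig : 576 * ((c : ℝ) + 4) ^ 3 ≤ Real.logb 2 m)
    (h5 : Real.logb 2 m ^ 5 ≤ (m : ℝ) ^ (7 / 8 : ℝ))
    (hT : (T : ℝ) ≤ 16 * ((c : ℝ) + 4) * Real.logb 2 m ^ 2 * ((m : ℝ) ^ (7 / 8 : ℝ) / Real.logb 2 m ^ 5)) :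
    (T + (Nat.log 2 m + 1) * (c + 1) + 2) * (2 * kOf m * ((2 * c + 8) * (Nat.log 2 m + 1)).choose 2) ≤ m := by
  obtain ⟨-, hΛ, hΛ0, -, -, hC, hk, -⟩ := logWidth_real_facts hm4 hbig
  have key := logWidth_budget_algebra_T (Nat.cast_nonneg c) hbig (Real.rpow_nonneg (Nat.cast_nonneg m) _) h5 hΛ hΛ0
    hC (Nat.cast_nonneg _) hk (Nat.cast_nonneg _) hT
  rw [rpow_eighth_mul_rpow_seven_eighths] at key
  exact_mod_cast key

/-- **Common bookkeeping at logarithmic width (registered auxiliary statement).** For every `c`, eventually in `m`, for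
every bit count `T ≤ 16 (c+4) log₂² m · m^{7/8}/(log₂ m)^5`, with `Λ = ⌊log₂ m⌋+1`, `L = (2c+8)Λ`, `t = (c+4)Λ`, `k = kOf m`,
`ν = ⌊m/(2 k C(L,2))⌋`: `m ≥ 1`, `0 ≤ q ≤ 1`, `1 - q^{C(L,2)} ≤ 1/2`, `0 < ε`, `2t ≤ L ≤ lOf m`, the positive budget
`(ν C(L,2))^t C(m-t,k-t) ≤ ε C(m,k)`, the bit budget `T + Λ(c+1) + 2 ≤ ν`, `m ≤ 2^Λ`, `1 ≤ log₂ m`, `log₂⁵ m ≤ m^{7/8}` and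
`Λ · L ≤ 8 (c+4) log₂² m`. [folklore] -/
theorem logWidth_common : ∀ c : ℕ, ∀ᶠ m : ℕ in atTop, ∀ T : ℕ,
    (T : ℝ) ≤ 16 * ((c : ℝ) + 4) * Real.logb 2 m ^ 2 * ((m : ℝ) ^ (7 / 8 : ℝ) / Real.logb 2 m ^ 5) →
    1 ≤ m ∧ 0 ≤ qOf m ∧ qOf m ≤ 1 ∧ 1 - qOf m ^ (((2 * c + 8) * (Nat.log 2 m + 1)).choose 2) ≤ 1 / 2 ∧
    0 < epsOf c m ∧ 2 * ((c + 4) * (Nat.log 2 m + 1)) ≤ (2 * c + 8) * (Nat.log 2 m + 1) ∧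
    (2 * c + 8) * (Nat.log 2 m + 1) ≤ lOf m ∧
    ((((m / (2 * kOf m * ((2 * c + 8) * (Nat.log 2 m + 1)).choose 2)) *
        ((2 * c + 8) * (Nat.log 2 m + 1)).choose 2) ^ ((c + 4) * (Nat.log 2 m + 1)) *
        (m - (c + 4) * (Nat.log 2 m + 1)).choose (kOf m - (c + 4) * (Nat.log 2 m + 1)) : ℕ) : ℝ) ≤
      epsOf c m * (m.choose (kOf m) : ℝ) ∧
    T + (Nat.log 2 m + 1) * (c + 1) + 2 ≤ m / (2 * kOf m * ((2 * c + 8) * (Nat.log 2 m + 1)).choose 2) ∧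
    m ≤ 2 ^ (Nat.log 2 m + 1) ∧ 1 ≤ Real.logb 2 m ∧ Real.logb 2 m ^ 5 ≤ (m : ℝ) ^ (7 / 8 : ℝ) ∧
    ((Nat.log 2 m : ℝ) + 1) * ((2 * (c : ℝ) + 8) * ((Nat.log 2 m : ℝ) + 1)) ≤ 8 * ((c : ℝ) + 4) * Real.logb 2 m ^ 2 := by
  intro c
  filter_upwards [denseRegime_params c, logWidth_le_lOf c, eventually_logb_pow_five_le,
    ((Real.tendsto_logb_atTop one_lt_two).comp tendsto_natCast_atTop_atTop).eventually_ge_atTop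
      (576 * ((c : ℝ) + 4) ^ 3)] with m ⟨hm4, hL16, hc3, _⟩ hLl h5 hbig T hT
  have hbig' : 576 * ((c : ℝ) + 4) ^ 3 ≤ Real.logb 2 m := by simpa [Function.comp_def] using hbig
  have hbits := logWidth_bits_of_T hm4 hbig' h5 hT
  obtain ⟨hℓ1, -, -, -, -, -, -, hΛL⟩ := logWidth_real_facts hm4 hbig'
  have hm1 : 1 ≤ m := by omega
  have hx2 : (2 : ℝ) ≤ (m : ℝ) ^ (1 / 16 : ℝ) := by linarith [(Nat.cast_nonneg c : (0 : ℝ) ≤ c)]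
  have hLk := four_mul_log_le_kOf hm1 hL16
  have hlk := lOf_add_one_le_kOf hx2
  have hq0 := qOf_nonneg hm1 hLk
  have hq1 := qOf_le_one m
  have hhalf : (1 / 2 : ℝ) ≤ qOf m ^ (((2 * c + 8) * (Nat.log 2 m + 1)).choose 2) :=
    (half_le_qOf_pow hm1 hLk).trans (pow_le_pow_of_le_one hq0 hq1 (Nat.choose_le_choose 2 hLl))
  have hmpos : (0 : ℝ) < m := by exact_mod_cast hm1
  have hε : 0 < epsOf c m := by
    rw [epsOf_eq]
    exact div_pos one_pos (mul_pos (by norm_num) (pow_pos hmpos _))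
  have h2t : 2 * ((c + 4) * (Nat.log 2 m + 1)) ≤ (2 * c + 8) * (Nat.log 2 m + 1) := le_of_eq (by ring)
  have htk : (c + 4) * (Nat.log 2 m + 1) ≤ kOf m := by
    have : (c + 4) * (Nat.log 2 m + 1) ≤ (2 * c + 8) * (Nat.log 2 m + 1) := Nat.mul_le_mul_right _ (by omega)
    omega
  have hn : 0 < 2 * kOf m * ((2 * c + 8) * (Nat.log 2 m + 1)).choose 2 := by
    have hk : 0 < kOf m := by omega
    have hL2 : 2 ≤ (2 * c + 8) * (Nat.log 2 m + 1) := le_trans (by omega) (Nat.le_mul_of_pos_right _ (by omega))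
    exact Nat.mul_pos (Nat.mul_pos two_pos hk) (Nat.choose_pos hL2)
  have hν : 2 * (m / (2 * kOf m * ((2 * c + 8) * (Nat.log 2 m + 1)).choose 2)) * kOf m *
      ((2 * c + 8) * (Nat.log 2 m + 1)).choose 2 ≤ m :=
    calc 2 * (m / (2 * kOf m * ((2 * c + 8) * (Nat.log 2 m + 1)).choose 2)) * kOf m *
          ((2 * c + 8) * (Nat.log 2 m + 1)).choose 2
        = m / (2 * kOf m * ((2 * c + 8) * (Nat.log 2 m + 1)).choose 2) *
            (2 * kOf m * ((2 * c + 8) * (Nat.log 2 m + 1)).choose 2) := by ring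
      _ ≤ m := Nat.div_mul_le_self m _
  exact ⟨hm1, hq0, hq1, by linarith, hε, h2t, hLl,
    pos_budget_of_base hm1 hν htk (kOf_le_self m) (four_mul_pow_le_two_pow_logWidth c m),
    (Nat.le_div_iff_mul_le hn).2 hbits, (Nat.lt_pow_succ_log_self one_lt_two m).le, hℓ1, h5, hΛL⟩

/-! ### Span programs over any division ring -/

/-- **`SGAt` for span programs of dimension `D ≤ m^{7/8}/(log₂ m)^5` over a given division ring `F`** (finite or not),
at the logarithmic width `L(c,m)`, at every level `c`, eventually in `m` (range `m^{11/16-o(1)} → m^{7/8-o(1)}`): the chain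
cover `sg_spanProgram_of_chain_budget` with the budgets of `logWidth_common` at `T = Λ·L·(D+1)` and the cover budget
`#𝒱(L)^D 2^{-(ν+1)} #𝒱(L) < ε` (`cover_budget_two_pow`, `#𝒱(L) ≤ 2^{ΛL}`). [folklore] -/
theorem sgAt_spanGateOver_logWidth : ∀ (F : Type) [DivisionRing F] (c : ℕ), ∀ᶠ m : ℕ in atTop,
    ∀ D : ℕ, (D : ℝ) ≤ (m : ℝ) ^ (7 / 8 : ℝ) / Real.logb 2 m ^ 5 →
      SGAt m (fun g => ∃ (r : Fin g.1 → Fin D → F) (t : Fin D → F),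
          ∀ v, g.2 v = true ↔ t ∈ Submodule.span F (r '' {i | v i = true}))
        ((2 * c + 8) * (Nat.log 2 m + 1)) (kOf m) (qOf m) (epsOf c m) := by
  intro F _ c
  filter_upwards [logWidth_common c] with m hm D hD O hO
  obtain ⟨g, ⟨r, t, hg⟩, X, hX, hOX⟩ := hO
  have hT : ((((Nat.log 2 m + 1) * ((2 * c + 8) * (Nat.log 2 m + 1)) * (D + 1) : ℕ) : ℝ)) ≤
      16 * ((c : ℝ) + 4) * Real.logb 2 m ^ 2 * ((m : ℝ) ^ (7 / 8 : ℝ) / Real.logb 2 m ^ 5) := by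
    obtain ⟨-, -, -, -, -, -, -, -, -, -, hℓ1, h5, hΛL⟩ := hm 0 (by
      push_cast
      exact mul_nonneg (mul_nonneg (by positivity) (sq_nonneg _))
        (div_nonneg (Real.rpow_nonneg (Nat.cast_nonneg m) _) (pow_nonneg (logb_two_nonneg m) 5)))
    have hβ1 : 1 ≤ (m : ℝ) ^ (7 / 8 : ℝ) / Real.logb 2 m ^ 5 := by
      rw [le_div_iff₀ (by positivity), one_mul]; exact h5
    have hD1 : ((D : ℝ) + 1) ≤ 2 * ((m : ℝ) ^ (7 / 8 : ℝ) / Real.logb 2 m ^ 5) := by linarith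
    push_cast
    have h0 : (0 : ℝ) ≤ ((Nat.log 2 m : ℝ) + 1) * ((2 * (c : ℝ) + 8) * ((Nat.log 2 m : ℝ) + 1)) := by positivity
    calc ((Nat.log 2 m : ℝ) + 1) * ((2 * (c : ℝ) + 8) * ((Nat.log 2 m : ℝ) + 1)) * ((D : ℝ) + 1)
        ≤ (8 * ((c : ℝ) + 4) * Real.logb 2 m ^ 2) * (2 * ((m : ℝ) ^ (7 / 8 : ℝ) / Real.logb 2 m ^ 5)) :=
          mul_le_mul hΛL hD1 (by positivity) (by positivity)
      _ = 16 * ((c : ℝ) + 4) * Real.logb 2 m ^ 2 * ((m : ℝ) ^ (7 / 8 : ℝ) / Real.logb 2 m ^ 5) := by ring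
  obtain ⟨hm1, hq0, hq1, hhalf, hε, h2t, -, hpos, hB, hmΛ, -, -, -⟩ := hm _ hT
  refine sg_spanProgram_of_chain_budget m _ (kOf m) D _ _ (qOf m) (epsOf c m) hq0 hq1 hhalf hε h2t hpos ?_
    r X hX t O fun x => ?_
  · have hV := card_smallSets_le_two_pow m ((2 * c + 8) * (Nat.log 2 m + 1))
    have hVR : (#(smallSets (Fin m) ((2 * c + 8) * (Nat.log 2 m + 1))) : ℝ) ≤
        (2 : ℝ) ^ ((Nat.log 2 m + 1) * ((2 * c + 8) * (Nat.log 2 m + 1))) := by exact_mod_cast hV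
    refine cover_budget_two_pow (a := (Nat.log 2 m + 1) * ((2 * c + 8) * (Nat.log 2 m + 1)) * D)
      (Λ := Nat.log 2 m + 1) hm1 (by positivity) ?_ hVR ?_ hmΛ
    · calc (#(smallSets (Fin m) ((2 * c + 8) * (Nat.log 2 m + 1))) : ℝ) ^ D
          ≤ ((2 : ℝ) ^ ((Nat.log 2 m + 1) * ((2 * c + 8) * (Nat.log 2 m + 1)))) ^ D :=
            pow_le_pow_left₀ (Nat.cast_nonneg _) hVR D
        _ = (2 : ℝ) ^ ((Nat.log 2 m + 1) * ((2 * c + 8) * (Nat.log 2 m + 1)) * D) := (pow_mul _ _ _).symm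
    · have h1 : (Nat.log 2 m + 1) * ((2 * c + 8) * (Nat.log 2 m + 1)) * D +
          (Nat.log 2 m + 1) * ((2 * c + 8) * (Nat.log 2 m + 1)) =
          (Nat.log 2 m + 1) * ((2 * c + 8) * (Nat.log 2 m + 1)) * (D + 1) := by ring
      omega
  · rw [hOX x, hg]
    have hset : {i | (fun a => atomB (X a) x) i = true} = {a | CliquePresent (X a) x} := by
      ext a
      simp [atomB]
    rw [hset]

/-! ### Commutative `PERM_d` gates -/

/-- **`SGAt` for commutative `PERM_d` gates with `log₂ d! ≤ m^{7/8}/(log₂ m)^5`** (was `m^{3/4}/2` at width `lOf m`), at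
the logarithmic width, at every level `c`, eventually in `m`: the character cover `sgAt_commPerm_of_cover_budget` with the
budgets of `logWidth_common` at `T = ⌊log₂ d!⌋ + 1 + Λ·L` and the cover budget `d! 2^{-(ν+1)} #𝒱(L) < ε`
(`d! ≤ 2^{⌊log₂ d!⌋+1}`). [folklore] -/
theorem sgAt_commPerm_logWidth : ∀ c : ℕ, ∀ᶠ m : ℕ in atTop, ∀ d : ℕ,
    Real.logb 2 (d.factorial) ≤ (m : ℝ) ^ (7 / 8 : ℝ) / Real.logb 2 m ^ 5 →
      SGAt m (fun g => ∃ d', d' ≤ d ∧ ∃ (σ : Fin g.1 → Equiv.Perm (Fin d')) (τ : Equiv.Perm (Fin d')),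
          (∀ i j, σ i * σ j = σ j * σ i) ∧ ∀ v, g.2 v = true ↔ τ ∈ Subgroup.closure (σ '' {i | v i = true}))
        ((2 * c + 8) * (Nat.log 2 m + 1)) (kOf m) (qOf m) (epsOf c m) := by
  intro c
  filter_upwards [logWidth_common c] with m hm d hd
  have hT : (((Nat.log 2 d.factorial + 1 + (Nat.log 2 m + 1) * ((2 * c + 8) * (Nat.log 2 m + 1)) : ℕ) : ℝ)) ≤
      16 * ((c : ℝ) + 4) * Real.logb 2 m ^ 2 * ((m : ℝ) ^ (7 / 8 : ℝ) / Real.logb 2 m ^ 5) := by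
    obtain ⟨-, -, -, -, -, -, -, -, -, -, hℓ1, h5, hΛL⟩ := hm 0 (by
      push_cast
      exact mul_nonneg (mul_nonneg (by positivity) (sq_nonneg _))
        (div_nonneg (Real.rpow_nonneg (Nat.cast_nonneg m) _) (pow_nonneg (logb_two_nonneg m) 5)))
    have hβ1 : 1 ≤ (m : ℝ) ^ (7 / 8 : ℝ) / Real.logb 2 m ^ 5 := by
      rw [le_div_iff₀ (by positivity), one_mul]; exact h5
    have hE : (Nat.log 2 d.factorial : ℝ) ≤ (m : ℝ) ^ (7 / 8 : ℝ) / Real.logb 2 m ^ 5 := by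
      have h := Real.natLog_le_logb d.factorial 2
      push_cast at h
      exact h.trans hd
    have hc0 : (0 : ℝ) ≤ c := Nat.cast_nonneg c
    have h8 : (2 : ℝ) ≤ 8 * ((c : ℝ) + 4) * Real.logb 2 m ^ 2 := by nlinarith
    push_cast
    set β := (m : ℝ) ^ (7 / 8 : ℝ) / Real.logb 2 m ^ 5 with hβ
    set P := 8 * ((c : ℝ) + 4) * Real.logb 2 m ^ 2 with hP
    have h1 : (Nat.log 2 d.factorial : ℝ) + 1 ≤ P * β := by nlinarith
    have h2 : ((Nat.log 2 m : ℝ) + 1) * ((2 * (c : ℝ) + 8) * ((Nat.log 2 m : ℝ) + 1)) ≤ P * β := by nlinarith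
    calc (Nat.log 2 d.factorial : ℝ) + 1 + ((Nat.log 2 m : ℝ) + 1) * ((2 * (c : ℝ) + 8) * ((Nat.log 2 m : ℝ) + 1))
        ≤ P * β + P * β := add_le_add h1 h2
      _ = 16 * ((c : ℝ) + 4) * Real.logb 2 m ^ 2 * β := by rw [hP]; ring
  obtain ⟨hm1, hq0, hq1, hhalf, hε, h2t, -, hpos, hB, hmΛ, -, -, -⟩ := hm _ hT
  refine sgAt_commPerm_of_cover_budget m _ (kOf m) d _ _ (qOf m) (epsOf c m) hq0 hq1 hhalf hε h2t hpos ?_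
  have hV := card_smallSets_le_two_pow m ((2 * c + 8) * (Nat.log 2 m + 1))
  have hVR : (#(smallSets (Fin m) ((2 * c + 8) * (Nat.log 2 m + 1))) : ℝ) ≤
      (2 : ℝ) ^ ((Nat.log 2 m + 1) * ((2 * c + 8) * (Nat.log 2 m + 1))) := by exact_mod_cast hV
  have hfac : ((d.factorial : ℕ) : ℝ) ≤ (2 : ℝ) ^ (Nat.log 2 d.factorial + 1) := by
    exact_mod_cast (Nat.lt_pow_succ_log_self one_lt_two d.factorial).le
  refine cover_budget_two_pow (Λ := Nat.log 2 m + 1) hm1 (Nat.cast_nonneg _) hfac hVR ?_ hmΛ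
  omega

/-! ### `𝔽_p`-span programs -/

/-- **`SGAt` for `𝔽_p`-span programs of dimension `D` with `D log₂ p ≤ m^{7/8}/(log₂ m)^5`** (was `m^{3/4}/2` at width
`lOf m`), at the logarithmic width, at every level `c`, eventually in `m`: the functional cover
`sg_spanProgram_of_cover_budget` with the budgets of `logWidth_common` at `T = (⌊log₂ p⌋+1) D + Λ·L` and the cover budget
`p^D 2^{-(ν+1)} #𝒱(L) < ε` (`p ≤ 2^{⌊log₂ p⌋+1}`). [folklore] -/
theorem sgAt_spanGate_zmod_logWidth : ∀ c : ℕ, ∀ᶠ m : ℕ in atTop, ∀ (p D : ℕ), p.Prime →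
    (D : ℝ) * Real.logb 2 p ≤ (m : ℝ) ^ (7 / 8 : ℝ) / Real.logb 2 m ^ 5 →
      SGAt m (fun g => ∃ (r : Fin g.1 → Fin D → ZMod p) (t : Fin D → ZMod p),
          ∀ v, g.2 v = true ↔ t ∈ Submodule.span (ZMod p) (r '' {i | v i = true}))
        ((2 * c + 8) * (Nat.log 2 m + 1)) (kOf m) (qOf m) (epsOf c m) := by
  intro c
  filter_upwards [logWidth_common c] with m hm p D hp hD O hO
  obtain ⟨g, ⟨r, t, hg⟩, X, hX, hOX⟩ := hO
  haveI : Fact p.Prime := ⟨hp⟩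
  have hp2 : (2 : ℝ) ≤ p := by exact_mod_cast hp.two_le
  have hT : ((((Nat.log 2 p + 1) * D + (Nat.log 2 m + 1) * ((2 * c + 8) * (Nat.log 2 m + 1)) : ℕ) : ℝ)) ≤
      16 * ((c : ℝ) + 4) * Real.logb 2 m ^ 2 * ((m : ℝ) ^ (7 / 8 : ℝ) / Real.logb 2 m ^ 5) := by
    obtain ⟨-, -, -, -, -, -, -, -, -, -, hℓ1, h5, hΛL⟩ := hm 0 (by
      push_cast
      exact mul_nonneg (mul_nonneg (by positivity) (sq_nonneg _))
        (div_nonneg (Real.rpow_nonneg (Nat.cast_nonneg m) _) (pow_nonneg (logb_two_nonneg m) 5)))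
    have hβ1 : 1 ≤ (m : ℝ) ^ (7 / 8 : ℝ) / Real.logb 2 m ^ 5 := by
      rw [le_div_iff₀ (by positivity), one_mul]; exact h5
    have hlp1 : 1 ≤ Real.logb 2 p := by
      rw [← Real.logb_self_eq_one one_lt_two]
      exact Real.logb_le_logb_of_le one_lt_two two_pos hp2
    have hlp : (Nat.log 2 p : ℝ) + 1 ≤ 2 * Real.logb 2 p := by
      have h := Real.natLog_le_logb p 2
      push_cast at h; linarith
    have hD0 : (0 : ℝ) ≤ D := Nat.cast_nonneg D
    have hE : ((Nat.log 2 p : ℝ) + 1) * D ≤ 2 * ((m : ℝ) ^ (7 / 8 : ℝ) / Real.logb 2 m ^ 5) := by nlinarith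
    have hc0 : (0 : ℝ) ≤ c := Nat.cast_nonneg c
    have h8 : (2 : ℝ) ≤ 8 * ((c : ℝ) + 4) * Real.logb 2 m ^ 2 := by nlinarith
    push_cast
    set β := (m : ℝ) ^ (7 / 8 : ℝ) / Real.logb 2 m ^ 5 with hβ
    set P := 8 * ((c : ℝ) + 4) * Real.logb 2 m ^ 2 with hP
    have h1 : ((Nat.log 2 p : ℝ) + 1) * D ≤ P * β := by nlinarith
    have h2 : ((Nat.log 2 m : ℝ) + 1) * ((2 * (c : ℝ) + 8) * ((Nat.log 2 m : ℝ) + 1)) ≤ P * β := by nlinarith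
    calc ((Nat.log 2 p : ℝ) + 1) * D + ((Nat.log 2 m : ℝ) + 1) * ((2 * (c : ℝ) + 8) * ((Nat.log 2 m : ℝ) + 1))
        ≤ P * β + P * β := add_le_add h1 h2
      _ = 16 * ((c : ℝ) + 4) * Real.logb 2 m ^ 2 * β := by rw [hP]; ring
  obtain ⟨hm1, hq0, hq1, hhalf, hε, h2t, -, hpos, hB, hmΛ, -, -, -⟩ := hm _ hT
  refine sg_spanProgram_of_cover_budget m _ (kOf m) D _ _ (qOf m) (epsOf c m) hq0 hq1 hhalf hε h2t hpos ?_
    r X hX t O fun x => ?_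
  · have hV := card_smallSets_le_two_pow m ((2 * c + 8) * (Nat.log 2 m + 1))
    have hVR : (#(smallSets (Fin m) ((2 * c + 8) * (Nat.log 2 m + 1))) : ℝ) ≤
        (2 : ℝ) ^ ((Nat.log 2 m + 1) * ((2 * c + 8) * (Nat.log 2 m + 1))) := by exact_mod_cast hV
    have hcard : (Fintype.card (ZMod p) : ℝ) ^ D ≤ (2 : ℝ) ^ ((Nat.log 2 p + 1) * D) := by
      rw [ZMod.card, pow_mul]
      exact pow_le_pow_left₀ (Nat.cast_nonneg _)
        (by exact_mod_cast (Nat.lt_pow_succ_log_self one_lt_two p).le) D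
    refine cover_budget_two_pow (Λ := Nat.log 2 m + 1) hm1 (by positivity) hcard hVR ?_ hmΛ
    omega
  · rw [hOX x, hg]
    have hset : {i | (fun a => atomB (X a) x) i = true} = {a | CliquePresent (X a) x} := by
      ext a
      simp [atomB]
    rw [hset]

end Summit.PneNP.PneNP.Theorems

end
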